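/-
Copyright (c) 2026 the pub-hodgecm-mathlib formalisation cell (harness21).  Prover seat hodgecm-mathlib-K2Liu-p05 (g3), 2026-09-04
(Track B «K2-LIT», crux hLiu418 = stmt-HodgeConjecture-24832, socket #42F′ `sig_K2LiuFirstTermIdentityOnGenerators`, ROAD I v3 («uniqueness road»,
RULING M-156b), organ U2 «rigidity» — the GLUE `K2LiuRankOneCoefficientComparison` of LEAD F0P6-plan (g12) 2026-09-04T06:37:18Z).
-/
import Summits.HodgeConjecture.HodgeConjecture.Theorems.K2LiuRankOneOrbitUniformity   -- ★ U2c 2∕2 (Hasse BY NAME): `lineGram_transport_of_locF_eq_of_totallyPositive`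
import HarnessLib

/-!
# U2 glue «RANK-ONE COEFFICIENT COMPARISON»: two coefficient families that vanish off the norm class, transform alike under rational
# congruence and are proportional at the reference index `β₀ = diag(a′, 0)` are proportional EVERYWHERE — and coefficient rigidity

Track B ∕ K2-LIT, hLiu418 = stmt-HodgeConjecture-24832, socket #42F′ (U6 ED. 10 :767), ROAD I v3 organ U2 (SIGS-RoadI-v3 §2 row U2 «RIGIDITY for
holomorphic-type images», script: «U2a ⇒ rank-2 `a_β(Tᵢx) = 0`; U2c (+Hol signs, +Hasse) ⇒ only the class of `β ∈ a′·N(L^×)`-orbit survives; on it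
U2b∕U2e ⇒ proportional at `β₀`; automorphy under `m(γ) ∈ ratH` ties all `β` to ONE constant; `D := T₁ − c T₂` has all non-constant coefficients zero ⇒
Hol ⇒ `D = 0`»).  Namespace `Summit.HodgeConjecture.HodgeConjecture.Cruxes.HLiu418.K2LiuRankOneCoefficientComparison`.  THEOREMS ONLY (no definition,
no instance, no notation, no named fact, no `sorry`); kernel lane `--supports stmt-HodgeConjecture-24832 --as helper`.  The analytic organs enter BY
VALUE as hypotheses with the names of the road: `h2₁ h2₂` = U2a (★ `eq_zero_of_twistedQuasiInvariant_rankTwo` ∕ `eq_zero_of_functional_rankTwo_conj`),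
`hfin` = U2c-fin at every finite place (★ `locF_eq_of_functional_ne_zero`) + U2c-arch (Hol's sign condition), `hT₁ hT₂` = automorphy of the coefficients
under the rational Levi (`a_{(cγ)ᵀβγ}(F)(h) = a_β(F)(m(γ)·h)` for left-`ratH`-invariant `F`; U3-fin shape), `h₁ h₂ hne` = U2b ∕ U2e ∕ U4b at the
reference index, `hdet` = Hol.3c (a holomorphic-type form with all non-constant coefficients zero is `0`).

* §1 ABSTRACT ORBIT COMPARISON (pure linear algebra over `ℂ`, any index type `I`, any reach map `act : Γ → I` of the reference index): transport
  `Aᵢ (act γ) = R γ ∘ Aᵢ β₀ ∘ S γ` + vanishing off the reached set + `A₁ β₀ = c • A₂ β₀` ⇒ `A₁ = c • A₂` (`forall_eq_smul_of_transport`); the constant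
  from a ONE-DIMENSIONAL space of admissible functionals at `β₀` (`eq_div_smul_of_line`); coefficient RIGIDITY (`forall_eq_smul_of_coeff`: if the
  coefficients `coeff β ∘ T₁ = c • coeff β ∘ T₂` agree and coefficients determine the members of the value class `P`, then `T₁ = c • T₂`).
* §2 THE CM FIELD, INDEX `Herm₂(L)` (the organ's glue): **`rankOneCoefficientComparison`** — for coefficient families `A₁ A₂` indexed by `β ∈ M₂(L)`:
  (rank 2) hermitian `β` with `det β ≠ 0` ⇒ `Aᵢ β = 0`; (rank 1) a non-vanishing `Aᵢ` at `β = b · c(u) ⊗ u` (`u` unimodular) forces `locF b = locF a′`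
  at every finite place and `b ∕ a′ ≫ 0`; (transport) `Aᵢ ((cγ)ᵀ β γ) = R γ ∘ Aᵢ β ∘ S γ` for invertible `γ`; (reference) `A₁ β₀ = c₀ • A₂ β₀` at
  `β₀ = diag(a′, 0)` ⟹ `A₁ β = c₀ • A₂ β` for EVERY hermitian `β ≠ 0`.  Mechanism: ★ `exists_eq_smul_vecMulVec_conj_of_det_eq_zero` («rank one = the
  class of `diag(b,0)`», `b = β_ii ∈ L⁺` by `IsCMField.complexConj_eq_self_iff`) + ★ `lineGram_transport_of_locF_eq_of_totallyPositive` (Hasse BY NAME)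
  put every surviving `β` in the congruence orbit of `β₀` through an EXPLICIT invertible `γ` (rows `e·u` and a unit vector), and ★
  `map_transpose_mul_diagonal_mul` reads `(cγ)ᵀ β₀ γ` as that Gram.  Packaged with the line hypotheses: **`exists_forall_eq_smul`**; with Hol.3c:
  **`rankOneRigidity`** (`∃ c, ∀ x, T₁ x = c • T₂ x` — the «⊢» of the sheet's U2 row, all analytic inputs by value).

HONEST LABEL: HC_CM is proved only modulo the 7 printed citations (2 remaining named inputs: hLiu418 = stmt-HodgeConjecture-24832, h413 =
stmt-HodgeConjecture-24833) until rung 0 closes; this file is the glue of organ U2 of Road I for #42F′ and moves no counter.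

## References
* [KudlaRallis1994] S. S. Kudla, S. Rallis, *A regularized Siegel–Weil formula: the first term identity*, Ann. of Math. 140 (1994) 1–80, §3 (support and
  homogeneity of the Fourier coefficients of theta lifts and Siegel–Weil residues).
* [Rallis1984] S. Rallis, *On the Howe duality conjecture*, Compositio Math. 51 (1984) 333–399, §4.
* [Omeara1963] O. T. O'Meara, *Introduction to Quadratic Forms* (1963), §65D Thm. 65:23 (Hasse norm theorem, through U2c).
* [Scharlau1985HermitianForms] W. Scharlau, *Quadratic and Hermitian Forms*, Grundlehren 270 (1985), Ch. 10 §1.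
-/

set_option autoImplicit false
set_option linter.dupNamespace false

noncomputable section

open Set NumberField IsDedekindDomain
open scoped Matrix
open Literature.NumberTheory.Automorphic.Liu2021.Def411WeilCarriers
open Literature.NumberTheory.GelbartRogawski1991.UnitaryDualPair
open Summit.HodgeConjecture.HodgeConjecture.Cruxes.HLiu418.K2LiuRankOneLineGram
open Summit.HodgeConjecture.HodgeConjecture.Cruxes.HLiu418.K2LiuRankOneOrbitUniformity

namespace Summit.HodgeConjecture.HodgeConjecture.Cruxes.HLiu418.K2LiuRankOneCoefficientComparison

/-! ## §1 Abstract orbit comparison and coefficient rigidity -/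

section Abstract

variable {I Γ : Type*} {D M : Type*} [AddCommGroup D] [Module ℂ D] [AddCommGroup M] [Module ℂ M]
  (A₁ A₂ : I → D →ₗ[ℂ] M) (β₀ : I) (act : Γ → I) (R : Γ → M →ₗ[ℂ] M) (S : Γ → D →ₗ[ℂ] D)

/-- **ABSTRACT ORBIT COMPARISON.**  Two families of functionals `A₁ A₂ : I → (D →ₗ M)` that (i) transform alike along the reach map `act : Γ → I` of a
reference index `β₀` (`Aᵢ (act γ) = R γ ∘ Aᵢ β₀ ∘ S γ`), (ii) BOTH vanish at every index not reached, and (iii) are proportional at `β₀`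
(`A₁ β₀ = c • A₂ β₀`) are proportional everywhere with the SAME constant. [cite: KudlaRallis1994, §3] -/
theorem forall_eq_smul_of_transport (hT₁ : ∀ γ, A₁ (act γ) = R γ ∘ₗ A₁ β₀ ∘ₗ S γ) (hT₂ : ∀ γ, A₂ (act γ) = R γ ∘ₗ A₂ β₀ ∘ₗ S γ)
    (h0 : ∀ β, (∀ γ, act γ ≠ β) → A₁ β = 0 ∧ A₂ β = 0) {c : ℂ} (hP : A₁ β₀ = c • A₂ β₀) : ∀ β, A₁ β = c • A₂ β := by
  intro β
  by_cases h : ∃ γ, act γ = β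
  · obtain ⟨γ, rfl⟩ := h
    rw [hT₁, hT₂, hP, LinearMap.smul_comp, LinearMap.comp_smul]
  · push Not at h
    obtain ⟨h₁, h₂⟩ := h0 β h
    rw [h₁, h₂, smul_zero]

/-- **the constant from a LINE of admissible functionals at `β₀`** (U2b ∕ U2e: both `Aᵢ β₀` are multiples of one `λ₀`; U4b: `A₂ β₀ ≠ 0`):
`A₁ β₀ = (c₁ ∕ c₂) • A₂ β₀`. [cite: KudlaRallis1994, §3] -/
theorem eq_div_smul_of_line {lam : D →ₗ[ℂ] M} {c₁ c₂ : ℂ} (h₁ : A₁ β₀ = c₁ • lam) (h₂ : A₂ β₀ = c₂ • lam) (hne : A₂ β₀ ≠ 0) :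
    A₁ β₀ = (c₁ / c₂) • A₂ β₀ := by
  have hc₂ : c₂ ≠ 0 := by
    rintro rfl
    exact hne (by rw [h₂, zero_smul])
  rw [h₁, h₂, smul_smul, div_mul_cancel₀ c₁ hc₂]

/-- **COEFFICIENT RIGIDITY.**  If the `β`-coefficients of `T₁ x` and `T₂ x` agree up to ONE constant (`coeff β ∘ T₁ = c • coeff β ∘ T₂` for the indices
in `J`) and the coefficients indexed by `J` DETERMINE the members of the value class `P ∋ T₁ x, T₂ x` (Hol.3c: a holomorphic-type form with all
non-constant Fourier coefficients zero is `0`), then `T₁ = c • T₂`. [cite: KudlaRallis1994, §3] -/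
theorem forall_eq_smul_of_coeff {N : Type*} [AddCommGroup N] [Module ℂ N] (T₁ T₂ : D →ₗ[ℂ] N) (coeff : I → N →ₗ[ℂ] M) (J : Set I)
    (P : Submodule ℂ N) (hP₁ : ∀ x, T₁ x ∈ P) (hP₂ : ∀ x, T₂ x ∈ P) (hdet : ∀ y ∈ P, (∀ β ∈ J, coeff β y = 0) → y = 0) {c : ℂ}
    (h : ∀ β ∈ J, coeff β ∘ₗ T₁ = c • (coeff β ∘ₗ T₂)) : ∀ x, T₁ x = c • T₂ x := by
  intro x
  have hmem : T₁ x - c • T₂ x ∈ P := P.sub_mem (hP₁ x) (P.smul_mem c (hP₂ x))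
  have hzero := hdet _ hmem fun β hβ => by
    have hx := LinearMap.congr_fun (h β hβ) x
    simp only [LinearMap.coe_comp, Function.comp_apply, LinearMap.smul_apply] at hx
    rw [map_sub, map_smul, hx, sub_self]
  exact sub_eq_zero.1 hzero

end Abstract

/-! ## §2 The CM field: coefficient families indexed by `Herm₂(L)`, reference index `β₀ = diag(a′, 0)` -/

section CM

variable (L : Type) [Field L] [NumberField L] [IsCMField L]
  {D M : Type*} [AddCommGroup D] [Module ℂ D] [AddCommGroup M] [Module ℂ M]
  (A₁ A₂ : Matrix (Fin 2) (Fin 2) L → D →ₗ[ℂ] M) (a' : (↥(maximalRealSubfield L))ˣ)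
  (R : Matrix (Fin 2) (Fin 2) L → M →ₗ[ℂ] M) (S : Matrix (Fin 2) (Fin 2) L → D →ₗ[ℂ] D)
  (hT₁ : ∀ γ : Matrix (Fin 2) (Fin 2) L, IsUnit γ.det → ∀ β : Matrix (Fin 2) (Fin 2) L,
    A₁ ((γ.map (IsCMField.complexConj L))ᵀ * β * γ) = R γ ∘ₗ A₁ β ∘ₗ S γ)
  (hT₂ : ∀ γ : Matrix (Fin 2) (Fin 2) L, IsUnit γ.det → ∀ β : Matrix (Fin 2) (Fin 2) L,
    A₂ ((γ.map (IsCMField.complexConj L))ᵀ * β * γ) = R γ ∘ₗ A₂ β ∘ₗ S γ)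
  (h2₁ : ∀ β : Matrix (Fin 2) (Fin 2) L, (β.map (IsCMField.complexConj L))ᵀ = β → β.det ≠ 0 → A₁ β = 0)
  (h2₂ : ∀ β : Matrix (Fin 2) (Fin 2) L, (β.map (IsCMField.complexConj L))ᵀ = β → β.det ≠ 0 → A₂ β = 0)
  (hfin : ∀ (b : (↥(maximalRealSubfield L))ˣ) (u : Fin 2 → L), (∃ k, u k = 1) →
    (A₁ (algebraMap ↥(maximalRealSubfield L) L b • Matrix.vecMulVec (⇑(IsCMField.complexConj L) ∘ u) u) ≠ 0 ∨
      A₂ (algebraMap ↥(maximalRealSubfield L) L b • Matrix.vecMulVec (⇑(IsCMField.complexConj L) ∘ u) u) ≠ 0) →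
    (∀ v : HeightOneSpectrum (𝓞 ↥(maximalRealSubfield L)),
        locF ↥(maximalRealSubfield L) (imagUnitSq L) b v = locF ↥(maximalRealSubfield L) (imagUnitSq L) a' v) ∧
      ∀ ρ : ↥(maximalRealSubfield L) →+* ℝ, 0 < ρ ((b : ↥(maximalRealSubfield L)) * ((a' : ↥(maximalRealSubfield L)))⁻¹))

include hT₁ hT₂ h2₁ h2₂ hfin in
/-- **U2 GLUE «RANK-ONE COEFFICIENT COMPARISON».**  Let `A₁ A₂` be two coefficient families indexed by `β ∈ M₂(L)` (`L` a CM field, `c` its conjugation,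
`a′ ∈ (L⁺)^×` the line) such that: (rank 2, U2a) `Aᵢ β = 0` for hermitian `β` with `det β ≠ 0`; (rank 1, U2c-fin + Hol signs) if some `Aᵢ` does not
vanish at `β = b · c(u) ⊗ u` (`b ∈ (L⁺)^×`, `u` unimodular) then `locF b v = locF a′ v` at EVERY finite `v` and `b ∕ a′` is totally positive; (transport,
automorphy under the rational Levi) `Aᵢ ((cγ)ᵀ β γ) = R γ ∘ Aᵢ β ∘ S γ` for invertible `γ`; (reference, U2b∕U2e∕U4b) `A₁ β₀ = c₀ • A₂ β₀` at
`β₀ = diag(a′, 0)`.  Then `A₁ β = c₀ • A₂ β` for EVERY hermitian `β ≠ 0` — by ★ U2c (`rank one = class of diag(b,0)`, Hasse BY NAME) every surviving `β` is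
`(cγ)ᵀ β₀ γ` for an explicit invertible `γ`. [cite: KudlaRallis1994, §3] [cite: Omeara1963, §65D Thm. 65:23] [cite: Scharlau1985HermitianForms, Ch. 10 §1] -/
theorem rankOneCoefficientComparison {c₀ : ℂ}
    (hP : A₁ (Matrix.diagonal ![algebraMap ↥(maximalRealSubfield L) L a', 0]) =
      c₀ • A₂ (Matrix.diagonal ![algebraMap ↥(maximalRealSubfield L) L a', 0])) :
    ∀ β : Matrix (Fin 2) (Fin 2) L, (β.map (IsCMField.complexConj L))ᵀ = β → β ≠ 0 → A₁ β = c₀ • A₂ β := by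
  intro β hβh hβ0
  by_cases hdet : β.det ≠ 0
  · rw [h2₁ β hβh hdet, h2₂ β hβh hdet, smul_zero]
  push Not at hdet
  -- rank one: `β = β_ii · c(u) ⊗ u`, `u_i = 1`, `β_ii ∈ L⁺`
  have hσ : ∀ x : L, (IsCMField.complexConj L : L →+* L) ((IsCMField.complexConj L : L →+* L) x) = x := fun x =>
    IsCMField.complexConj_apply_apply L x
  have hcoe : (⇑(IsCMField.complexConj L : L →+* L)) = ⇑(IsCMField.complexConj L) := rfl
  have hβh' : (β.map ⇑(IsCMField.complexConj L : L →+* L))ᵀ = β := by rw [hcoe]; exact hβh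
  obtain ⟨i, u, hui, hii0, hiifix, hβ⟩ := exists_eq_smul_vecMulVec_conj_of_det_eq_zero (IsCMField.complexConj L : L →+* L) hσ β hβh' hdet hβ0
  rw [hcoe] at hβ hiifix
  obtain ⟨b, hb⟩ : ∃ b : ↥(maximalRealSubfield L), algebraMap ↥(maximalRealSubfield L) L b = β i i :=
    ⟨⟨β i i, (IsCMField.complexConj_eq_self_iff L (β i i)).1 hiifix⟩, rfl⟩
  have hb0 : b ≠ 0 := by
    rintro rfl
    exact hii0 (by rw [← hb, map_zero])
  -- either both coefficients vanish at `β`, or `β` is in the congruence orbit of `β₀`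
  by_cases hz : A₁ β = 0 ∧ A₂ β = 0
  · rw [hz.1, hz.2, smul_zero]
  have hne : A₁ β ≠ 0 ∨ A₂ β ≠ 0 := by
    by_contra h
    push Not at h
    exact hz h
  have hβb : β = algebraMap ↥(maximalRealSubfield L) L ((Units.mk0 b hb0 : (↥(maximalRealSubfield L))ˣ) : ↥(maximalRealSubfield L)) •
      Matrix.vecMulVec (⇑(IsCMField.complexConj L) ∘ u) u := by
    rw [Units.val_mk0, hb]; exact hβ
  rw [hβb] at hne
  obtain ⟨hloc, hpos⟩ := hfin (Units.mk0 b hb0) u ⟨i, hui⟩ hne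
  obtain ⟨e, he0, he⟩ := lineGram_transport_of_locF_eq_of_totallyPositive L a' (Units.mk0 b hb0) u hloc hpos
  -- an explicit invertible `γ` with first row `e • u`: second row the OTHER unit vector
  obtain ⟨γ, hγdet, hγ0⟩ : ∃ γ : Matrix (Fin 2) (Fin 2) L, IsUnit γ.det ∧ γ 0 = e • u := by
    fin_cases i
    · simp only [Fin.zero_eta, Fin.isValue] at hui
      refine ⟨Matrix.of ![e • u, Pi.single 1 1], ?_, rfl⟩
      rw [Matrix.det_fin_two, isUnit_iff_ne_zero]
      simp [hui, he0]
    · simp only [Fin.mk_one, Fin.isValue] at hui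
      refine ⟨Matrix.of ![e • u, Pi.single 0 1], ?_, rfl⟩
      rw [Matrix.det_fin_two, isUnit_iff_ne_zero]
      simp [hui, he0]
  have hβγ : β = (γ.map (IsCMField.complexConj L))ᵀ * Matrix.diagonal ![algebraMap ↥(maximalRealSubfield L) L a', 0] * γ := by
    have h2 := map_transpose_mul_diagonal_mul (IsCMField.complexConj L : L →+* L) (algebraMap ↥(maximalRealSubfield L) L a') γ
    rw [hcoe, hγ0] at h2
    rw [h2, hβb]
    exact he
  rw [hβγ, hT₁ γ hγdet, hT₂ γ hγdet, hP, LinearMap.smul_comp, LinearMap.comp_smul]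

include hT₁ hT₂ h2₁ h2₂ hfin in
/-- **… packaged with the LINE at the reference index** (U2b∕U2e: `Aᵢ β₀ = cᵢ • λ₀`; U4b: `A₂ β₀ ≠ 0`): `∃ c, ∀` hermitian `β ≠ 0`, `A₁ β = c • A₂ β`.
[cite: KudlaRallis1994, §3] [cite: Omeara1963, §65D Thm. 65:23] -/
theorem exists_forall_eq_smul {lam : D →ₗ[ℂ] M} {c₁ c₂ : ℂ}
    (h₁ : A₁ (Matrix.diagonal ![algebraMap ↥(maximalRealSubfield L) L a', 0]) = c₁ • lam)
    (h₂ : A₂ (Matrix.diagonal ![algebraMap ↥(maximalRealSubfield L) L a', 0]) = c₂ • lam)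
    (hne : A₂ (Matrix.diagonal ![algebraMap ↥(maximalRealSubfield L) L a', 0]) ≠ 0) :
    ∃ c : ℂ, ∀ β : Matrix (Fin 2) (Fin 2) L, (β.map (IsCMField.complexConj L))ᵀ = β → β ≠ 0 → A₁ β = c • A₂ β :=
  ⟨c₁ / c₂, rankOneCoefficientComparison L A₁ A₂ a' R S hT₁ hT₂ h2₁ h2₂ hfin
    (eq_div_smul_of_line A₁ A₂ (Matrix.diagonal ![algebraMap ↥(maximalRealSubfield L) L a', 0]) h₁ h₂ hne)⟩

end CM

section Rigidity

variable (L : Type) [Field L] [NumberField L] [IsCMField L]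
  {D M N : Type*} [AddCommGroup D] [Module ℂ D] [AddCommGroup M] [Module ℂ M] [AddCommGroup N] [Module ℂ N]
  (T₁ T₂ : D →ₗ[ℂ] N) (coeff : Matrix (Fin 2) (Fin 2) L → N →ₗ[ℂ] M) (a' : (↥(maximalRealSubfield L))ˣ)
  (R : Matrix (Fin 2) (Fin 2) L → M →ₗ[ℂ] M) (S : Matrix (Fin 2) (Fin 2) L → D →ₗ[ℂ] D)
  (P : Submodule ℂ N) (hP₁ : ∀ x, T₁ x ∈ P) (hP₂ : ∀ x, T₂ x ∈ P)
  (hdet : ∀ y ∈ P, (∀ β : Matrix (Fin 2) (Fin 2) L, (β.map (IsCMField.complexConj L))ᵀ = β → β ≠ 0 → coeff β y = 0) → y = 0)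
  (hT₁ : ∀ γ : Matrix (Fin 2) (Fin 2) L, IsUnit γ.det → ∀ β : Matrix (Fin 2) (Fin 2) L,
    coeff ((γ.map (IsCMField.complexConj L))ᵀ * β * γ) ∘ₗ T₁ = R γ ∘ₗ (coeff β ∘ₗ T₁) ∘ₗ S γ)
  (hT₂ : ∀ γ : Matrix (Fin 2) (Fin 2) L, IsUnit γ.det → ∀ β : Matrix (Fin 2) (Fin 2) L,
    coeff ((γ.map (IsCMField.complexConj L))ᵀ * β * γ) ∘ₗ T₂ = R γ ∘ₗ (coeff β ∘ₗ T₂) ∘ₗ S γ)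
  (h2₁ : ∀ β : Matrix (Fin 2) (Fin 2) L, (β.map (IsCMField.complexConj L))ᵀ = β → β.det ≠ 0 → coeff β ∘ₗ T₁ = 0)
  (h2₂ : ∀ β : Matrix (Fin 2) (Fin 2) L, (β.map (IsCMField.complexConj L))ᵀ = β → β.det ≠ 0 → coeff β ∘ₗ T₂ = 0)
  (hfin : ∀ (b : (↥(maximalRealSubfield L))ˣ) (u : Fin 2 → L), (∃ k, u k = 1) →
    (coeff (algebraMap ↥(maximalRealSubfield L) L b • Matrix.vecMulVec (⇑(IsCMField.complexConj L) ∘ u) u) ∘ₗ T₁ ≠ 0 ∨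
      coeff (algebraMap ↥(maximalRealSubfield L) L b • Matrix.vecMulVec (⇑(IsCMField.complexConj L) ∘ u) u) ∘ₗ T₂ ≠ 0) →
    (∀ v : HeightOneSpectrum (𝓞 ↥(maximalRealSubfield L)),
        locF ↥(maximalRealSubfield L) (imagUnitSq L) b v = locF ↥(maximalRealSubfield L) (imagUnitSq L) a' v) ∧
      ∀ ρ : ↥(maximalRealSubfield L) →+* ℝ, 0 < ρ ((b : ↥(maximalRealSubfield L)) * ((a' : ↥(maximalRealSubfield L)))⁻¹))

include hP₁ hP₂ hdet hT₁ hT₂ h2₁ h2₂ hfin in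
/-- **U2 «RANK-ONE RIGIDITY» (the sheet's «⊢»): `∃ c, ∀ x, T₁ x = c • T₂ x`.**  Two maps `T₁ T₂ : D →ₗ N` into a value class `P` whose members are
DETERMINED by their non-constant hermitian coefficients (`hdet`, Hol.3c), with coefficient families `β ↦ coeff β ∘ Tᵢ` obeying U2a (`h2ᵢ`),
U2c-fin + signs (`hfin`), automorphy (`hTᵢ`) and the line at `β₀ = diag(a′, 0)` (`h₁ h₂`, U2b∕U2e) with `coeff β₀ ∘ T₂ ≠ 0` (U4b), are PROPORTIONAL.
[cite: KudlaRallis1994, §3] [cite: Omeara1963, §65D Thm. 65:23] -/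
theorem rankOneRigidity {lam : D →ₗ[ℂ] M} {c₁ c₂ : ℂ}
    (h₁ : coeff (Matrix.diagonal ![algebraMap ↥(maximalRealSubfield L) L a', 0]) ∘ₗ T₁ = c₁ • lam)
    (h₂ : coeff (Matrix.diagonal ![algebraMap ↥(maximalRealSubfield L) L a', 0]) ∘ₗ T₂ = c₂ • lam)
    (hne : coeff (Matrix.diagonal ![algebraMap ↥(maximalRealSubfield L) L a', 0]) ∘ₗ T₂ ≠ 0) :
    ∃ c : ℂ, ∀ x, T₁ x = c • T₂ x := by
  obtain ⟨c, hc⟩ := exists_forall_eq_smul L (fun β => coeff β ∘ₗ T₁) (fun β => coeff β ∘ₗ T₂) a' R S hT₁ hT₂ h2₁ h2₂ hfin h₁ h₂ hne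
  refine ⟨c, forall_eq_smul_of_coeff T₁ T₂ coeff
    {β | (β.map (IsCMField.complexConj L))ᵀ = β ∧ β ≠ 0} P hP₁ hP₂ (fun y hy hyz => hdet y hy fun β hβh hβ0 => hyz β ⟨hβh, hβ0⟩)
    fun β hβ => hc β hβ.1 hβ.2⟩

end Rigidity

end Summit.HodgeConjecture.HodgeConjecture.Cruxes.HLiu418.K2LiuRankOneCoefficientComparison

end
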